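import Summits.QuantumFields.YangMills.Theorems.F4SubCurvatureDoorGlobalReductionCertificate
import Summits.QuantumFields.YangMills.Theorems.F4SubCurvatureDoorLaplaceFourierRegistered
import Summits.QuantumFields.YangMills.Theorems.F4SubCurvatureDoorFischerNormalForm
import Mathlib
import HarnessLib

/-!
# LINE g21-B «FIBRE DICHOTOMY» for ⟨stmt-QuantumFields-23125⟩ `F4SubCurvatureDoor.RationalToGeneral`
# (crux C3 = global short-root rigidity; rung R2d of LADDER-YM via `F4SubCurvatureDoor.closes`; seat ym-idea-3 g21, card «positivity / convexity»)

No summit and no rung is proved here.  This is a proof SKELETON: registered stubs + a kernel-checked composition concluding the crux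
BY NAME (`RationalToGeneral_of_fibres`).  It SUPERSEDES the wall stub `stub_shellFiniteType` (S3, XL) of LINE g21-A `shell_separation`
by two M–L statements and keeps g21-A's two load-bearing stubs S1/S2 verbatim (shared, served once).

## Thesis
C3 ⇐ S1 «forward-cone support» + S2 «shell separation» + B4 «single-shell dichotomy» + B5 «fibre reduction», where B4 and B5 are
classical-size (M–L) and carry NO tower / infinite-ascent problem.

## The lever (new; positivity card): THE BUDGET IS A GROWTH BOUND ON A POSITIVE MEASURE, AND GROWTH IS ADDITIVE OVER SHELLS
(1) On the time axis the class kernel is the Laplace transform of its Laplace–Fourier measure, `K(t e₀) = L_μ(t) = ∫ e^{−tE} dμ`, so the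
    sub-curvature budget `‖x‖⁸ K(x) → 0` gives `t⁸ L_μ(t) → 0` — a statement about the POSITIVE measure `μ` in which nothing can cancel.
(2) Reflection positivity in the 24 short-root directions `u` (all images of `e₀` under `W(F₄)`) gives the two-point Cauchy–Schwarz
    DOMINATION `|K(x)| ≤ L_μ(x·u)` (`x·u > 0`), hence `sup_{‖x‖=r} |K| ≤ L_μ(r/√2)` (the 24-cell covers `S³` with angular radius 45°).
    So the budget on the axis IS the budget, and it is inherited by every positive piece `μ' ≤ μ` that is itself symmetric.
(3) After S1 + S2 the measure disintegrates along the mass `q = E² − |q⃗|²` into fibres `ν_s` (`s ≥ 0`) that are POSITIVE, single-shell and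
    SYMMETRIC (their Laplace–Fourier evaluations are `W(F₄)`-invariant off the mirrors).  B4: such a fibre is EITHER radial OR its axis
    function obeys `t⁸ L_ν(t) ≥ c > 0` for all small `t` — because its kernel solves `(Δ − s)K̃ = 0` on `ℝ⁴ ∖ 0`, every `W(F₄)`-invariant
    harmonic component of degree `L` is a multiple `a_L φ_{L,s}(r)` of THE solution of the radial equation bounded at infinity, which is
    positive with `φ_{L,s}(r) ≍ r^{−L−2}` at `0`, invariant harmonics exist only in degrees `L ∈ {0, 6, 8, 12, …}`, and domination (2) bounds
    `|a_L| φ_{L,s}(r) ≤ C · L_ν(r/√2)`.  The degree gap `1 … 5` of `W(F₄)` is EXACTLY what makes the threshold `r⁻⁸ = r^{−6−2}` bite.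
(4) B5: `t⁸ L_μ(t) = ∫ t⁸ L_{ν_s}(t) dρ(s) → 0` with non-negative integrands, so by FATOU `liminf_t t⁸ L_{ν_s}(t) = 0` for `ρ`-a.e. `s`; by B4
    a.e. fibre is radial; integrate back: `K` is radial off `0`; the tree certificate `rationalToGeneral_of_global` concludes.
The feared «budgeted infinite ascent» (towers of shells whose anisotropic layers cancel in the expansion of `K` at `0`, HOME
`l17/T1pp_tower_economy*.md`, g21-A S3e) cannot occur: cancellation between shells happens in `K` (signed), never in `μ{E ≤ Λ}` or `L_μ`
(positive), and B4 converts anisotropy of a single fibre into GROWTH of that fibre.  Consistency check with the sharpness target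
`Cruxes/ShortRootRigidity/BigOBudgetSharpnessTarget.lean`: for the single sextic shell `h₆(∂)Δ_m`, B4's bound reads `|a₆| φ_{6,m}(r) ≤ C L(r/√2)`
with both sides `≍ r⁻⁸` — no contradiction under a big-O budget, contradiction under little-o: the line is tight exactly where C3 is.

## Why easier than C3 (equivalence rule)
S1 ∧ S2 ∧ B4 ∧ B5 ⇒ C3, and C3 ⇒ each of them (radial class kernels are Källén–Lehmann superpositions).  B4 is a statement about ONE positive
measure on ONE hyperboloid (Helmholtz equation off the origin, one radial ODE per harmonic degree, a finite reflection group's harmonic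
invariants, a two-point Cauchy–Schwarz); B5 is measure theory (disintegration `Measure.condKernel`, Tonelli, `lintegral_liminf_le`).  The only
XL statement left is S1, the 4-D spectral condition, whose planar model is LINE `angular_type`'s stub (C) with rungs R0/R1⁺/R1/S2 proved today.

## Stubs (registered by this file; ONE active skeleton per crux, so every stub still wanted is re-declared verbatim)
* S1 `stub_forwardConeSupport : ForwardConeSupport` (XL; verbatim from g21-A, shared).
* S2 `stub_shellSeparation : ShellSeparation` (M–L; verbatim from g21-A, shared; rungs R-S2a/R-S2c in `Lines/shell_separation_rungs.lean`).
* B4 `stub_singleShellDichotomy : SingleShellDichotomy` (M–L; NEW, the load-bearing novelty).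
* B5 `stub_fibreReduction : FibreReduction` (M; NEW; disintegration + Fatou).
* orphans kept served for the line of record `sextic_channel` (NOT used here): `stub_channelShellForm`, `stub_analyticFiniteType` (verbatim).
* DROPPED from the registry by this registration: g21-A's `stub_shellFiniteType` (superseded by B4 + B5; its file stays as the fallback line;
  its finite-shell rungs R-S3fin/R-S3fin⁺ remain valid by-name targets and are COROLLARIES of B4 + B5).
Landed, used by name: `stub_laplaceFourier` (✓ tree).  Composition: `radial_of_fibres`, `globalRigidity_of_radial`, `RationalToGeneral_of_fibres`.

## Cheapest falsifier / instrument
B4 on the explicit family `ν = (a₀ + a₆ h₆(E, i q⃗)) Ω_m ≥ 0`: the axis function is `a₀ m K₁(mt)/t·c + a₆ c′ t⁻¹ K₇(mt)`-type with `t⁸ L_ν(t) →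
a₆ c″ m⁻⁶ > 0` — alternative 2 with an explicit `c`; a symbolic check (no kit needed).  B5's only analytic input is `t⁸ K(t e₀) → 0`, which is
literally the fifth conjunct of `InClass` on the axis.  KILL: a positive symmetric single-shell measure whose kernel is anisotropic but has
`liminf_t t⁸ L_ν(t) = 0` — by (3) this requires a `W(F₄)`-invariant harmonic of degree `1 ≤ L ≤ 5`, which does not exist (Molien series of `F₄`:
degrees 2, 6, 8, 12), or a bounded-at-infinity radial solution regular at `0` for `s ≥ 0`, which does not exist either.

## Dead lines avoided / Disproof used
No `Disproof.lean` exists for ⟨23125⟩/⟨23035⟩ (checked 2026-08-29).  Dead lines: joint disintegration along all invariants (atomises μ — we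
disintegrate along `q` only, AFTER S2 made it legitimate); mass cut-offs «lose the budget» (g21-A screen) — WRONG, corrected here: the budget is
monotone under `μ' ≤ μ` by (1)–(2); triangular moment pairing / Mellin budget / layered alternation A′ (one-sided or finite-layer only) — not
needed; tangent-floor, Almgren, smoothing semigroups, Chevalley lift, Pick/Löwner (HOME POSITIVITY-CENSUS g3–g13) — untouched.
HONEST LABEL: ⟨23125⟩, ⟨23035⟩, R2d and the YM mass gap remain OPEN; no summit is proved by a line.
-/

set_option autoImplicit false

noncomputable section

namespace Summit.QuantumFields.YangMills.Cruxes.RationalToGeneral.FibreDichotomy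

open scoped Topology BigOperators
open Filter Set MeasureTheory
open Literature.MathematicalPhysics.QuantumLattice (timeReflection siteToE)
open Summit.QuantumFields.YangMills.Cruxes.OSLegsAtWeakCouplingC.Sketch (IsSignedPerm)
open Summit.QuantumFields.YangMills.Theses.F4SubCurvatureDoor (ShortRootRigidity RationalToGeneral)
open Summit.QuantumFields.YangMills.Theorems.F4SubCurvatureDoorGlobalReduction (rationalToGeneral_of_global)
open Summit.QuantumFields.YangMills.Theorems.F4SubCurvatureDoorLaplaceFourierRegistered
  (E4 E3 InClass timeSpace IsLF LaplaceFourier stub_laplaceFourier)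
open Summit.QuantumFields.YangMills.Theorems.F4SubCurvatureDoorFischerNormalForm (laplacian IsHarmonicPoly)

/-! ## Vocabulary (the first three verbatim from `Lines/shell_separation.lean`) -/

/-- The MASS SQUARED `q = E² − |q⃗|²` of a Laplace–Fourier momentum `(E, q⃗)` (verbatim from g21-A). -/
def massSq (p : ℝ × E3) : ℝ := p.1 ^ 2 - ‖p.2‖ ^ 2

/-- The BUDGET-FREE class (verbatim from g21-A). -/
def InClass₀ (K : E4 → ℝ) : Prop :=
  ContinuousOn K {x | x ≠ 0} ∧
  (∃ C : ℝ, ∀ x, 1 ≤ ‖x‖ → |K x| ≤ C) ∧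
  (∀ R : E4 ≃ₗᵢ[ℝ] E4, IsSignedPerm R → ∀ x, K (R x) = K x) ∧
  (∀ (m : ℕ) (x : Fin m → E4) (c : Fin m → ℝ), (∀ i, 0 < x i 0) →
      0 ≤ ∑ i, ∑ j, c i * c j * K (timeReflection 4 (x i) - x j)) ∧
  (∀ R : E4 ≃ₗᵢ[ℝ] E4,
      (∀ z : Fin 4 → ℤ, Even (∑ i, z i) → ∃ w : Fin 4 → ℤ, Even (∑ i, w i) ∧ R (siteToE z) = siteToE w) →
      ∀ x, K (R x) = K x)

/-- `μ` is SHELL-SEPARATED (verbatim from g21-A). -/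
def ShellSeparated (μ : Measure (ℝ × E3)) : Prop :=
  ∀ S : Set ℝ, MeasurableSet S → ∃ KS : E4 → ℝ, InClass₀ KS ∧ IsLF KS (μ.restrict (massSq ⁻¹' S))

/-- The spatial part `x⃗` of a Euclidean point (problem-side definition; `spacePart (timeSpace t z) = z`). -/
def spacePart (x : E4) : E3 := (WithLp.equiv 2 (Fin 3 → ℝ)).symm (fun j : Fin 3 => x j.succ)

/-- LAPLACE–FOURIER EVALUATION of a measure at a Euclidean point, time read as `|x₀|` (problem-side definition): for the
Laplace–Fourier measure `μ` of a class kernel `K`, `lfEval μ x = K x` whenever `x₀ ≠ 0`. -/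
def lfEval (ν : Measure (ℝ × E3)) (x : E4) : ℝ :=
  ∫ p : ℝ × E3, Real.exp (-(|x 0| * p.1)) * Real.cos (inner ℝ p.2 (spacePart x)) ∂ν

/-- `R` preserves the even lattice `D₄` (the clause of the crux and of `InClass`; these are the 1152 elements of `W(F₄)`). -/
def IsD4Isometry (R : E4 ≃ₗᵢ[ℝ] E4) : Prop :=
  ∀ z : Fin 4 → ℤ, Even (∑ i, z i) → ∃ w : Fin 4 → ℤ, Even (∑ i, w i) ∧ R (siteToE z) = siteToE w

/-- A measure is LF-SYMMETRIC: its Laplace–Fourier evaluation is `W(F₄)`-invariant at all points where both times are non-zero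
(problem-side definition; this is what S2 delivers fibrewise). -/
def SymmetricLF (ν : Measure (ℝ × E3)) : Prop :=
  ∀ R : E4 ≃ₗᵢ[ℝ] E4, IsD4Isometry R → ∀ x : E4, x 0 ≠ 0 → (R x) 0 ≠ 0 → lfEval ν (R x) = lfEval ν x

/-- A SINGLE-SHELL measure of mass² `s`: carried by the closed forward cone and by the shell `{E² − |q⃗|² = s}`, Laplace-integrable
(problem-side definition). -/
def IsShellMeasure (ν : Measure (ℝ × E3)) (s : ℝ) : Prop :=
  ν {p | p.1 < ‖p.2‖} = 0 ∧ ν {p | massSq p ≠ s} = 0 ∧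
  ∀ t : ℝ, 0 < t → Integrable (fun p : ℝ × E3 => Real.exp (-(t * p.1))) ν

/-! ## The two shared obligations (verbatim from g21-A `shell_separation`) -/

/-- Stub S1 «FORWARD-CONE SUPPORT» (XL; verbatim from g21-A — shared, served once). -/
def ForwardConeSupport : Prop :=
  ∀ K : E4 → ℝ, InClass K → ∀ μ : Measure (ℝ × E3), IsLF K μ → μ {p | p.1 < ‖p.2‖} = 0

/-- Stub S2 «SHELL SEPARATION» (M–L; verbatim from g21-A — shared, served once). -/
def ShellSeparation : Prop :=
  ∀ K : E4 → ℝ, InClass K → ∀ μ : Measure (ℝ × E3), IsLF K μ →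
    ∀ Q₀ : ℝ, μ {p | massSq p < -Q₀} = 0 → ShellSeparated μ

/-! ## The two new obligations -/

/-- Stub B4 «SINGLE-SHELL DICHOTOMY» (M–L; THE NEW LEVER): a positive, Laplace-integrable, forward-cone, single-shell measure whose
Laplace–Fourier evaluation is `W(F₄)`-symmetric is EITHER radial (off the time-zero mirror) OR has axis growth `t⁸ · L_ν(t) ≥ c > 0` for all
small `t`.  Content: frame patching (`C^∞` off `0`), `(Δ − s)K̃ = 0`, harmonic projections solve `g'' + (3/r)g' − (L(L+2)/r² + s)g = 0`, bounded at
`∞` ⇒ multiple of the decaying solution `φ_{L,s} > 0`, `φ_{L,s}(r) r^{L+2} → c_L > 0`; RP two-point domination `|K̃(x)| ≤ L_ν(‖x‖/√2)`;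
`W(F₄)`-invariant harmonics live in degrees `0, 6, 8, 12, …` only.  [Widder1941 Ch. VI; AxlerBourdonRamey2001 Ch. 5; GlimmJaffeQP1987 §6.2;
OsterwalderSchraderCMP1973 (RP Cauchy–Schwarz)]  WHY IT MIGHT FAIL: it should not — the one place to watch is the `s = 0` fibre (null cone +
a possible atom at the origin: constants are radial, massless components have `φ_{L,0} = r^{−L−2}`). -/
def SingleShellDichotomy : Prop :=
  ∀ (ν : Measure (ℝ × E3)) (s : ℝ), IsShellMeasure ν s → SymmetricLF ν →
    (∃ g₀ : ℝ → ℝ, ∀ x : E4, x 0 ≠ 0 → lfEval ν x = g₀ (‖x‖ ^ 2)) ∨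
    (∃ c : ℝ, 0 < c ∧ ∃ t₀ : ℝ, 0 < t₀ ∧ ∀ t : ℝ, 0 < t → t < t₀ → c ≤ t ^ 8 * lfEval ν (timeSpace t 0))

/-- Stub B5 «FIBRE REDUCTION» (M; disintegration + Fatou): given the single-shell dichotomy, a class kernel whose Laplace–Fourier measure is
carried by the forward cone and shell-separated is radial off `0`.  Content: disintegrate the finite measure `e^{−E}μ` along `massSq`
(`Measure.condKernel` on a standard Borel space) into probability fibres; a.e. fibre is Laplace-integrable (Tonelli), single-shell, cone-carried,
and LF-symmetric (shell separation tested on a countable generating family of mass windows × a countable dense set of points × the finite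
group); the axis identity `t⁸ K(t e₀) = ∫ t⁸ L_{ν_s}(t) dρ(s) → 0` (budget = fifth conjunct of `InClass`) and Fatou (`lintegral_liminf_le`)
exclude the dichotomy's second alternative a.e.; integrate the radial fibres back and extend across the mirror by symmetry of `K`.
[Mathlib `ProbabilityTheory.condKernel`, `MeasureTheory.lintegral_liminf_le`]  WHY IT MIGHT FAIL: Lean plumbing only (kernels, a.e. swaps). -/
def FibreReduction : Prop :=
  SingleShellDichotomy →
    ∀ K : E4 → ℝ, InClass K → ∀ μ : Measure (ℝ × E3), IsLF K μ →
      μ {p | p.1 < ‖p.2‖} = 0 → ShellSeparated μ →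
      ∃ g₀ : ℝ → ℝ, ∀ x : E4, x ≠ 0 → K x = g₀ (‖x‖ ^ 2)

theorem stub_forwardConeSupport : ForwardConeSupport := by
  sorry

theorem stub_shellSeparation : ShellSeparation := by
  sorry

theorem stub_singleShellDichotomy : SingleShellDichotomy := by
  sorry

theorem stub_fibreReduction : FibreReduction := by
  sorry

/-! ## Orphan stubs of the line of record `sextic_channel`, re-declared verbatim so that they stay served (NOT used below) -/

/-- `sextic_channel`'s T1″ «ANALYTIC FINITE TYPE» (verbatim). -/
def AnalyticFiniteType : Prop :=
  ∀ K : E4 → ℝ, InClass K → (∀ x : E4, x ≠ 0 → AnalyticAt ℝ K x) →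
    ∃ (N : ℕ) (P : Fin N → MvPolynomial (Fin 4) ℝ) (g : Fin N → ℝ → ℝ),
      ∀ x : E4, x ≠ 0 → K x = ∑ j, g j (‖x‖ ^ 2) * MvPolynomial.eval (fun i => x i) (P j)

/-- Complex evaluation at the forward null momentum `(i‖q⃗‖, q⃗)` (verbatim from `sextic_channel`). -/
def nullEval (P : MvPolynomial (Fin 4) ℝ) (q : E3) : ℂ :=
  MvPolynomial.aeval (Fin.cons (Complex.I * (‖q‖ : ℂ)) (fun j : Fin 3 => ((q j : ℝ) : ℂ))) P

/-- `sextic_channel`'s «CHANNEL SHELL FORM» (verbatim). -/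
def ChannelShellForm : Prop :=
  ∀ K : E4 → ℝ, InClass K → ∀ μ : Measure (ℝ × E3), IsLF K μ →
    ∀ (ι : Type) [Fintype ι] (H : ι → MvPolynomial (Fin 4) ℝ) (d : ι → ℕ) (g : ι → ℝ → ℝ),
      (∀ k, (H k).IsHomogeneous (d k)) → (∀ k, IsHarmonicPoly (H k)) →
      (∀ x : E4, x ≠ 0 → K x = ∑ k, g k (‖x‖ ^ 2) * MvPolynomial.eval (fun i => x i) (H k)) →
      ∀ L : ℕ, 0 < L → (∀ k, d k ≤ L) →
      ∃ (φ : ℝ → ℝ) (A : Type) (_ : Fintype A) (Ht : A → MvPolynomial (Fin 4) ℝ) (ρp ρm : A → Measure ℝ) (C : ℝ → ℝ),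
        Measurable φ ∧ (∀ u, 0 ≤ φ u) ∧ ContinuousWithinAt φ (Set.Ici 0) 0 ∧ 0 < φ 0 ∧
        (∀ a, (Ht a).IsHomogeneous L) ∧ (∀ a, IsHarmonicPoly (Ht a)) ∧ LinearIndependent ℝ Ht ∧
        (∀ a (q : E3), (nullEval (Ht a) q).im = 0) ∧
        (∀ a, IsLocallyFiniteMeasure (ρp a) ∧ IsLocallyFiniteMeasure (ρm a)) ∧
        (∀ a, (ρp a) (Set.Iio 0) = 0 ∧ (ρm a) (Set.Iio 0) = 0) ∧
        (∀ S : Set ℝ, MeasurableSet S → Bornology.IsBounded S →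
            ∀ q : E3, 0 ≤ ∑ a, (((ρp a) S).toReal - ((ρm a) S).toReal) * (nullEval (Ht a) q).re) ∧
        (∀ a (r : ℝ), 0 < r → Integrable (fun M => φ (M * r)) (ρp a) ∧ Integrable (fun M => φ (M * r)) (ρm a)) ∧
        (∀ a, Tendsto (fun r : ℝ => (∫ M, φ (M * r) ∂(ρp a)) - ∫ M, φ (M * r) ∂(ρm a)) (𝓝[>] 0) (𝓝 0)) ∧
        (∀ x : E4, x ≠ 0 →
          ∑ k ∈ Finset.univ.filter (fun k => d k = L), g k (‖x‖ ^ 2) * MvPolynomial.eval (fun i => x i) (H k)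
            = C ‖x‖ * ∑ a, MvPolynomial.eval (fun i => x i) (Ht a) *
                ((∫ M, φ (M * ‖x‖) ∂(ρp a)) - ∫ M, φ (M * ‖x‖) ∂(ρm a)))

/-- Re-declared open stub of `sextic_channel` (T1″; kept claimable, NOT used by this line). -/
theorem stub_analyticFiniteType : AnalyticFiniteType := by
  sorry

/-- Re-declared open stub of `sextic_channel` (L; kept claimable, NOT used by this line). -/
theorem stub_channelShellForm : ChannelShellForm := by
  sorry

/-! ## Sanity lemmas on the vocabulary (proved) -/

theorem timeSpace_zero (t : ℝ) (z : E3) : (timeSpace t z) 0 = t := by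
  simp [timeSpace]

theorem spacePart_timeSpace (t : ℝ) (z : E3) : spacePart (timeSpace t z) = z := by
  ext j
  simp [spacePart, timeSpace]

/-- On the positive-time half-space the Laplace–Fourier evaluation of a representing measure IS the kernel. -/
theorem lfEval_timeSpace (K : E4 → ℝ) (μ : Measure (ℝ × E3)) (hμ : IsLF K μ) (t : ℝ) (ht : 0 < t) (z : E3) :
    lfEval μ (timeSpace t z) = K (timeSpace t z) := by
  rw [lfEval, timeSpace_zero, spacePart_timeSpace, abs_of_pos ht, hμ.2.2 t z ht]

/-- Deep space-like mass is absent under forward-cone support (verbatim from g21-A). -/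
theorem massSq_neg_null (μ : Measure (ℝ × E3)) (hc : μ {p | p.1 < ‖p.2‖} = 0) :
    μ {p | massSq p < -0} = 0 := by
  refine measure_mono_null (fun p hp => ?_) hc
  simp only [Set.mem_setOf_eq, massSq, neg_zero, sub_neg] at hp ⊢
  exact lt_of_le_of_lt (le_abs_self _) (abs_lt_of_sq_lt_sq hp (norm_nonneg _))

/-! ## Composition (proved): S1 + S2 + B4 + B5 ⇒ every class kernel is radial ⇒ C3 ⇒ ⟨23125⟩ -/

/-- **NEW COMPOSITION (proved)**: the four stubs and the tree's Laplace–Fourier measure make every class kernel radial off `0`. -/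
theorem radial_of_fibres (h1 : ForwardConeSupport) (h2 : ShellSeparation) (h4 : SingleShellDichotomy) (h5 : FibreReduction) :
    ∀ K : E4 → ℝ, InClass K → ∃ g₀ : ℝ → ℝ, ∀ x : E4, x ≠ 0 → K x = g₀ (‖x‖ ^ 2) := by
  intro K hK
  obtain ⟨μ, hμ⟩ := stub_laplaceFourier K hK
  have hc : μ {p | p.1 < ‖p.2‖} = 0 := h1 K hK μ hμ
  have hsep : ShellSeparated μ := h2 K hK μ hμ 0 (massSq_neg_null μ hc)
  exact h5 h4 K hK μ hμ hc hsep

/-- Radial class kernels satisfy C3's global conclusion (every linear isometry fixes `K`). -/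
theorem globalRigidity_of_radial
    (hrad : ∀ K : E4 → ℝ, InClass K → ∃ g₀ : ℝ → ℝ, ∀ x : E4, x ≠ 0 → K x = g₀ (‖x‖ ^ 2)) :
    ∀ K : EuclideanSpace ℝ (Fin 4) → ℝ,
      ContinuousOn K {x | x ≠ 0} →
      (∃ C : ℝ, ∀ x, 1 ≤ ‖x‖ → |K x| ≤ C) →
      (∀ R : EuclideanSpace ℝ (Fin 4) ≃ₗᵢ[ℝ] EuclideanSpace ℝ (Fin 4), IsSignedPerm R → ∀ x, K (R x) = K x) →
      (∀ (m : ℕ) (x : Fin m → EuclideanSpace ℝ (Fin 4)) (c : Fin m → ℝ), (∀ i, 0 < x i 0) →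
          0 ≤ ∑ i, ∑ j, c i * c j * K (timeReflection 4 (x i) - x j)) →
      Tendsto (fun x : EuclideanSpace ℝ (Fin 4) => ‖x‖ ^ 8 * K x) (𝓝[≠] 0) (𝓝 0) →
      (∀ R : EuclideanSpace ℝ (Fin 4) ≃ₗᵢ[ℝ] EuclideanSpace ℝ (Fin 4),
          (∀ z : Fin 4 → ℤ, Even (∑ i, z i) → ∃ w : Fin 4 → ℤ, Even (∑ i, w i) ∧ R (siteToE z) = siteToE w) →
          ∀ x, K (R x) = K x) →
      ∀ (R : EuclideanSpace ℝ (Fin 4) ≃ₗᵢ[ℝ] EuclideanSpace ℝ (Fin 4)) (x : EuclideanSpace ℝ (Fin 4)),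
        K (R x) = K x := by
  intro K hK hbd hB hRP hbud hlat R x
  have hcls : InClass K := ⟨hK, hbd, hB, hRP, hbud, hlat⟩
  obtain ⟨g₀, hr⟩ := hrad K hcls
  by_cases hx : x = 0
  · subst hx; simp
  · have hRx : R x ≠ 0 := by
      intro h0
      apply hx
      have hn : ‖R x‖ = 0 := by rw [h0, norm_zero]
      rw [LinearIsometryEquiv.norm_map] at hn
      exact norm_eq_zero.mp hn
    rw [hr (R x) hRx, hr x hx, LinearIsometryEquiv.norm_map]

/-- **SKELETON THEOREM (LINE g21-B)**: the served leaf ⟨23125⟩ `RationalToGeneral` from the registered stubs `stub_forwardConeSupport`,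
`stub_shellSeparation` (shared with g21-A), `stub_singleShellDichotomy`, `stub_fibreReduction` (new), the landed `stub_laplaceFourier`
(tree, by name), the proved compositions above and the tree certificate `rationalToGeneral_of_global`. -/
theorem RationalToGeneral_of_fibres : RationalToGeneral :=
  rationalToGeneral_of_global
    (globalRigidity_of_radial
      (radial_of_fibres stub_forwardConeSupport stub_shellSeparation stub_singleShellDichotomy stub_fibreReduction))

end Summit.QuantumFields.YangMills.Cruxes.RationalToGeneral.FibreDichotomy

end
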